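import Summits.ResolutionOfSingularities.ResolutionOfSingularities.Theorems.HilbertSamuelEliminationSigmaMaxModificationsCorridor3WLadderStrataCentreDispatch
import Summits.ResolutionOfSingularities.ResolutionOfSingularities.Theorems.HilbertSamuelEliminationSigmaMaxModificationsCorridor3WLadderStrataNearFibreGeomDir
import HarnessLib

/-!
# [OURS · L1 W4.2] The STRATA-half of the MOVING W-ladder, tenth layer, β-twin: kernel (K-ctr) DISPATCHED FOR EVERY ORIGIN from the
# (F1♯) binders, and the REGIME-FREE strata row `WlowStrataM p` from (K-ctr-pt) ∧ (K-ctr-cv) ∧ (c-geo) — PROVED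

Crux chain w42 (`SigmaMaxModifications`, stmt-ResolutionOfSingularities-18506; skeleton `w_ladder` on `SigmaMaxModificationsCorridor3`,
stmt-ResolutionOfSingularities-19249), rows «stub-4 → `Moving.Wlow3CharStrataM p` / β-twin `WlowStrataM p`» (CHAIN v3.11 RULING (1): the
socket `hS` of stub-3's `wlow3TwoM_of_residue`), seat res-L1-w42-stub-4 (gen 4); companion of p522551 (dispatch in the (F1) regime),
p517608 (β-twin of (b-fib)/(b-curve), the OURS binder `Theorem314_nearFibre_geomDir`), p521289 ((K-str) CLOSED), p518012. OURS (cell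
res-hironaka, slot W4.2); NOT statements of H. Hironaka's manuscript [Hironaka2017] nor of [CossartJannsenSaito2020]; AI-drafted, weaker
than expert review. Pure proofs (no definitions). Helper file `--supports stmt-ResolutionOfSingularities-19249`.

* `strataCentreMembersClean_of_point_curve_geomDir : Theorem314_geomDir → Theorem314_nearFibre_geomDir → ∀ Q, (K-ctr-pt)_Q →
  (K-ctr-cv)_Q → StrataCentreMembersClean p 3 (QNe Q) (ē ≤ 2)` — the dispatch for every origin predicate ((F1♯) is automatic at
  `ē ≤ 2`, stub-3's `geomDirHypothesis_of_geomDirDim_le_two`);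
* `wlowStrataM_of_geomDir_point_curve_centreIO : Theorem314_geomDir → Theorem314_nearFibre_geomDir → (K-ctr-pt)⊤ → (K-ctr-cv)⊤ →
  (c-geo)⊤ → WlowStrataM p` — **the regime-free strata row from two (F1♯) binders and three one-step / local geometric kernels**
  ((K-str) is a theorem, p521289), and the `Q`-generic form `maxOriginNoMovingNearChainAtQ_notIso_of_geomDir_point_curve_centreIO`.

References: CJS LNM 2270 Thm. 3.14, Rem. 6.29 (1) [CossartJannsenSaito2020]; this seat's p517608 / p518012 / p521289 / p522551.
-/

noncomputable section

-- plan-1/idea-2 module setting kept (namespace `…Corridor3.Moving` re-enters `…Corridor3`)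
set_option linter.dupNamespace false

open CategoryTheory AlgebraicGeometry TopologicalSpace Topology IsLocalRing
open Summit.ResolutionOfSingularities.ResolutionOfSingularities.Theorems.CampaignW42
open Literature.AlgebraicGeometry.Resolution Literature.RingTheory.HilbertSamuel
open Literature.AlgebraicGeometry.CossartJannsenSaito2020
open Summit.ResolutionOfSingularities.ResolutionOfSingularities.Theorems.SigmaMaxModificationsCorridor3

universe u

namespace Summit.ResolutionOfSingularities.ResolutionOfSingularities.Theorems.SigmaMaxModificationsCorridor3.Moving

variable {R : ∀ S : Scheme.{u}, CentreSeq S → Prop} {N : ℕ} {ν : ℕ → ℕ}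

/-! ## The dispatch for every origin predicate -/

/-- **KERNEL (K-ctr) FROM ITS POINT-GERM AND CURVE-GERM CASES, FOR EVERY ORIGIN PREDICATE `Q`** (modulo the two (F1♯) binders
`Theorem314_geomDir` / `Theorem314_nearFibre_geomDir`, whose hypotheses are automatic at `ē ≤ 2`): the dispatch of p522551 verbatim
with (F1) replaced by (F1♯). [cite: CossartJannsenSaito2020, Thm. 3.14, Def. 3.1, Rem. 6.29 (1)] -/
theorem strataCentreMembersClean_of_point_curve_geomDir {p : ℕ} (hF : Theorem314_geomDir.{u})
    (hFf : Theorem314_nearFibre_geomDir.{u}) (Q : ℕ → (ℕ → ℕ) → ∀ X : Scheme.{u}, X → Prop)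
    (hpt : StrataPointCentreMembersClean.{u} p 3 (QNe Q) fun s => s.geomDirDim ≤ 2)
    (hcv : StrataCurveCentreDominantClean.{u} p 3 (QNe Q) fun s => s.geomDirDim ≤ 2) :
    StrataCentreMembersClean.{u} p 3 (QNe Q) fun s => s.geomDirDim ≤ 2 := by
  intro R hRf hRa ν X _ x hX hQ c h0 hstep hG hnI hmov
  obtain ⟨n₁, hn₁⟩ := hpt R hRf hRa ν X x hX hQ c h0 hstep hG hnI hmov
  obtain ⟨n₂, hn₂⟩ := hcv R hRf hRa ν X x hX hQ c h0 hstep hG hnI hmov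
  obtain ⟨-, hν⟩ := hQ
  obtain ⟨k, _, _, g, -, hft, hqc⟩ := hX.exists_structure
  haveI := hft
  haveI := hqc
  haveI := hX.isReduced
  obtain ⟨-, k', _, hinv⟩ := exists_cycleInv_chain' hRf hRa hX h0 hstep
  refine ⟨max n₁ n₂, fun n hn C P' hcs hxC f hf => ?_⟩
  -- standing facts at stage `n`
  have hgood : StateGood k R 3 ν (c n).W (c n).L (c n).P :=
    stateGood_of_reaches (stateGood_init_general hRa g hX.dim_le hX.maximal hν) (reaches_chain h0 hstep n)
  have hgdh : @GeomDirHypothesis (c n).W (c n).ln (c n).pt := @geomDirHypothesis_of_geomDirDim_le_two (c n).W (c n).ln (c n).pt (hG n)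
  haveI : IsLocallyNoetherian (c n).W := (c n).ln
  haveI : IsNoetherian (c n).W := (hinv n).isNoetherian
  have hptn : (c n).pt ∈ Scheme.hsStratum (c n).W 3 ν := pt_mem_hsStratum_of_reaches hX.mem_stratum (reaches_chain h0 hstep n)
  have hptcl : IsClosed ({(c n).pt} : Set (c n).W) := Reaches.isClosed_pt hX.isClosed (reaches_chain h0 hstep n)
  have hpt' : (c (n + 1)).pt ∈ Scheme.hsStratum (c (n + 1)).W 3 ν :=
    pt_mem_hsStratum_of_reaches hX.mem_stratum (reaches_chain h0 hstep (n + 1))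
  obtain ⟨hCreg, -, -, -⟩ := (hinv n).centre hRa hν hcs
  -- Thm. 3.14 numerical at this step, and `e ≤ ē ≤ 2`
  have h314n := centreDim_lt_dirDim_of_isBlownUp_geomDir hF hRf hgood hptn (hstep n) hgdh hcs hxC
  have he2 : (dirDim (c n) : WithBot ℕ∞) ≤ 2 := by
    have h1 : dirDim (c n) ≤ 2 := (Scheme.dirDim_le_geomDirDim (c n).pt).trans (hG n)
    exact_mod_cast h1
  -- the image closure of a member: irreducible closed, through `x_n`, inside `V(C)`
  have hA : ∀ Z' ∈ componentsThrough 3 ν (c (n + 1)), f.base '' Z' ⊆ (C.support : Set (c n).W) →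
      IsIrreducible (closure (f.base '' Z')) ∧ (c n).pt ∈ closure (f.base '' Z') ∧
        closure (f.base '' Z') ⊆ (C.support : Set (c n).W) := fun Z' hZ' hZ'C =>
    ⟨((componentsIn.isIrreducible hZ'.1).image _ f.continuous.continuousOn).closure,
      subset_closure ⟨_, hZ'.2, hf.base_pt⟩, closure_minimal hZ'C C.support.isClosed⟩
  -- a member inside the NEAR FIBRE is impossible at a never-isolated point
  have hnofibre : (dirDim (c n) : WithBot ℕ∞) ≤ ringKrullDim ((c n).W.presheaf.stalk (c n).pt ⧸ stalkIdeal C (c n).pt) + 1 →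
      ∀ Z' ∈ componentsThrough 3 ν (c (n + 1)), f.base '' Z' ⊆ {(c n).pt} → False := by
    intro he Z' hZ' hZ'x
    have hsub := hf.nearFibre_subsingleton_geomDir hFf hRf hcs hgood.isExcellent (hgood.isPermissible hcs) hgood.dim_le hxC hgdh hptn he
    have hZ'fib : Z' ⊆ {z : (c (n + 1)).W | f.base z = (c n).pt ∧ z ∈ Scheme.hsStratum (c (n + 1)).W 3 ν} :=
      fun z hz => ⟨hZ'x ⟨z, hz, rfl⟩, componentsIn.subset hZ'.1 hz⟩
    have hZ'eq : Z' = {(c (n + 1)).pt} :=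
      Set.Subset.antisymm (fun z hz => hsub (hZ'fib hz) (hZ'fib hZ'.2)) (Set.singleton_subset_iff.mpr hZ'.2)
    exact (hinv (n + 1)).singleton_notMem_componentsIn_of_not_iso hpt' (hnI (n + 1)) (hZ'eq ▸ hZ'.1)
  by_cases hgerm : ∀ a ∈ (C.support : Set (c n).W), a ⤳ (c n).pt → a = (c n).pt
  · -- POINT germ: every member lies over `x_n`
    have hover : ∀ Z' ∈ componentsThrough 3 ν (c (n + 1)), f.base '' Z' ⊆ (C.support : Set (c n).W) →
        f.base '' Z' ⊆ {(c n).pt} := by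
      intro Z' hZ' hZ'C
      obtain ⟨hirr, hxA, hAC⟩ := hA Z' hZ' hZ'C
      have hgen : IsGenericPoint hirr.genericPoint (closure (f.base '' Z')) := hirr.isGenericPoint_genericPoint isClosed_closure
      have ha : hirr.genericPoint = (c n).pt := hgerm _ (hAC hgen.mem) (hgen.specializes hxA)
      have hAeq : closure (f.base '' Z') = {(c n).pt} := by rw [← hgen.def, ha, hptcl.closure_eq]
      exact subset_closure.trans hAeq.le
    by_cases he : dirDim (c n) = 2
    · obtain ⟨hu, hr⟩ := hn₁ n (le_of_max_le_left hn) C P' hcs hxC hgerm he f hf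
      exact ⟨fun Z' hZ' Z'' hZ'' h' h'' => hu Z' hZ' Z'' hZ'' (hover Z' hZ' h') (hover Z'' hZ'' h''),
        fun Z' hZ' h' => hr Z' hZ' (hover Z' hZ' h')⟩
    · -- `e ≤ 1`: no member at all
      have hdim0 := ringKrullDim_quotient_le_zero_of_forall_specializes C hgerm
      have hJm : stalkIdeal C (c n).pt ≤ maximalIdeal ((c n).W.presheaf.stalk (c n).pt) := by
        have := (mem_support_iff_stalkIdeal_le_primeOfSpecializes (specializes_refl (c n).pt) C).mp hxC
        rwa [Literature.AlgebraicGeometry.Resolution.primeOfSpecializes_refl] at this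
      have hJtop : stalkIdeal C (c n).pt ≠ ⊤ := fun h =>
        (maximalIdeal.isMaximal ((c n).W.presheaf.stalk (c n).pt)).ne_top (top_le_iff.mp (h ▸ hJm))
      haveI : Nontrivial ((c n).W.presheaf.stalk (c n).pt ⧸ stalkIdeal C (c n).pt) :=
        Ideal.Quotient.nontrivial_iff.mpr hJtop
      have hle : (dirDim (c n) : WithBot ℕ∞) ≤
          ringKrullDim ((c n).W.presheaf.stalk (c n).pt ⧸ stalkIdeal C (c n).pt) + 1 := by
        have h1 : dirDim (c n) ≤ 1 := by
          have : dirDim (c n) ≤ 2 := (Scheme.dirDim_le_geomDirDim (c n).pt).trans (hG n)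
          omega
        have h1' : (dirDim (c n) : WithBot ℕ∞) ≤ 1 := by exact_mod_cast h1
        have h0 : (0 : WithBot ℕ∞) ≤ ringKrullDim ((c n).W.presheaf.stalk (c n).pt ⧸ stalkIdeal C (c n).pt) :=
          ringKrullDim_nonneg_of_nontrivial
        calc (dirDim (c n) : WithBot ℕ∞) ≤ 0 + 1 := by simpa using h1'
          _ ≤ _ := add_le_add h0 le_rfl
      exact ⟨fun Z' hZ' _ _ h' _ => (hnofibre hle Z' hZ' (hover Z' hZ' h')).elim,
        fun Z' hZ' h' => (hnofibre hle Z' hZ' (hover Z' hZ' h')).elim⟩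
  · -- CURVE germ: `1 ≤ dim 𝒪_{V(C),x_n}`, no fibre member, members dominate THE component of `V(C)` through `x_n`
    push Not at hgerm
    obtain ⟨a, haC, hax, hane⟩ := hgerm
    have h1 : (1 : WithBot ℕ∞) ≤ ringKrullDim ((c n).W.presheaf.stalk (c n).pt ⧸ stalkIdeal C (c n).pt) :=
      one_le_ringKrullDim_quotient_stalkIdeal C hax hane haC
    have hle : (dirDim (c n) : WithBot ℕ∞) ≤ ringKrullDim ((c n).W.presheaf.stalk (c n).pt ⧸ stalkIdeal C (c n).pt) + 1 := by
      refine he2.trans ?_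
      have h2 : (2 : WithBot ℕ∞) = 1 + 1 := by norm_num
      rw [h2]
      exact add_le_add h1 le_rfl
    have hlt2 : ringKrullDim ((c n).W.presheaf.stalk (c n).pt ⧸ stalkIdeal C (c n).pt) < 2 := h314n.trans_le he2
    -- the image closure of a member is a component of `V(C)` through `x_n`, not `{x_n}`
    have hcomp : ∀ Z' ∈ componentsThrough 3 ν (c (n + 1)), f.base '' Z' ⊆ (C.support : Set (c n).W) →
        closure (f.base '' Z') ∈ componentsIn (C.support : Set (c n).W) ∧ closure (f.base '' Z') ≠ {(c n).pt} := by
      intro Z' hZ' hZ'C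
      obtain ⟨hirr, hxA, hAC⟩ := hA Z' hZ' hZ'C
      have hne : closure (f.base '' Z') ≠ {(c n).pt} := fun heq =>
        hnofibre hle Z' hZ' (subset_closure.trans heq.le)
      refine ⟨?_, hne⟩
      obtain ⟨D, hD, hAD⟩ := exists_componentsIn_superset C.support.isClosed (componentsIn.finite _) hirr hAC
      by_contra hnot
      have hAD' : closure (f.base '' Z') ≠ D := fun h => hnot (h ▸ hD)
      have hDirr : IsIrreducible D := componentsIn.isIrreducible hD
      have hDcl : IsClosed D := componentsIn.isClosed C.support.isClosed hD
      have hAgen : IsGenericPoint hirr.genericPoint (closure (f.base '' Z')) := hirr.isGenericPoint_genericPoint isClosed_closure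
      have hDgen : IsGenericPoint hDirr.genericPoint D := hDirr.isGenericPoint_genericPoint hDcl
      have hbx : hirr.genericPoint ⤳ (c n).pt := hAgen.specializes hxA
      have hηb : hDirr.genericPoint ⤳ hirr.genericPoint := hDgen.specializes (hAD hAgen.mem)
      have hne₁ : hirr.genericPoint ≠ (c n).pt := by
        intro h; apply hne; rw [← hAgen.def, h, hptcl.closure_eq]
      have hne₂ : hDirr.genericPoint ≠ hirr.genericPoint := by
        intro h; apply hAD'; rw [← hAgen.def, ← hDgen.def, h]
      have h2 := two_le_ringKrullDim_quotient_stalkIdeal C hbx hηb hne₁ hne₂ ((componentsIn.subset hD) hDgen.mem) (hAC hAgen.mem)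
      exact absurd (h2.trans_lt hlt2) (lt_irrefl _)
    refine ⟨fun Z' hZ' Z'' hZ'' h' h'' => ?_, fun Z' hZ' h' => ?_⟩
    · obtain ⟨hc', hne'⟩ := hcomp Z' hZ' h'
      obtain ⟨hc'', -⟩ := hcomp Z'' hZ'' h''
      have heq : closure (f.base '' Z') = closure (f.base '' Z'') :=
        eq_of_mem_componentsIn_of_isRegular hCreg hc' hc'' (hA Z' hZ' h').2.1 (hA Z'' hZ'' h'').2.1
      exact (hn₂ n (le_of_max_le_right hn) C P' hcs f hf _ hc' (hA Z' hZ' h').2.1 hne').1 Z' hZ' Z'' hZ'' rfl heq.symm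
    · obtain ⟨hc', hne'⟩ := hcomp Z' hZ' h'
      exact (hn₂ n (le_of_max_le_right hn) C P' hcs f hf _ hc' (hA Z' hZ' h').2.1 hne').2 Z' hZ' rfl


/-- **The strata row at any origin predicate FROM the two (F1♯) binders, (K-ctr-pt), (K-ctr-cv) and (c-geo)** ((K-str) being a
theorem, p521289; (b-fib)/(b-curve) closed from the binders, p517608). [cite: CossartJannsenSaito2020, Thm. 3.14, Rem. 6.29 (1)] -/
theorem maxOriginNoMovingNearChainAtQ_notIso_of_geomDir_point_curve_centreIO {p : ℕ}
    {Q : ℕ → (ℕ → ℕ) → ∀ X : Scheme.{u}, X → Prop} (hF : Theorem314_geomDir.{u}) (hFf : Theorem314_nearFibre_geomDir.{u})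
    (hpt : StrataPointCentreMembersClean.{u} p 3 (QNe Q) fun s => s.geomDirDim ≤ 2)
    (hcv : StrataCurveCentreDominantClean.{u} p 3 (QNe Q) fun s => s.geomDirDim ≤ 2)
    (hgeo : StrataLineageInCentreIO p 3 (QNe Q) fun s => s.geomDirDim ≤ 2) :
    MaxOriginNoMovingNearChainAtQ p 3 Q fun s => s.geomDirDim ≤ 2 ∧ ¬ Iso 3 s :=
  maxOriginNoMovingNearChainAtQ_notIso_of_fibre_curve_centreIO_centreMembersClean
    (strataNearFibreSubsingleton_of_theorem314_nearFibre_geomDir hFf p Q) (strataCentreCurveAt_of_theorem314_geomDir hF p Q) hgeo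
    (strataCentreMembersClean_of_point_curve_geomDir hF hFf Q hpt hcv)

/-- **`WlowStrataM p` — THE REGIME-FREE STRATA ROW (stub-3's socket `hS`) FROM the two (F1♯) binders, (K-ctr-pt)⊤, (K-ctr-cv)⊤ and
(c-geo)⊤.** [cite: CossartJannsenSaito2020, Thm. 3.14, Thm. 6.35, Rem. 6.29 (1)] -/
theorem wlowStrataM_of_geomDir_point_curve_centreIO {p : ℕ} (hF : Theorem314_geomDir.{0})
    (hFf : Theorem314_nearFibre_geomDir.{0})
    (hpt : StrataPointCentreMembersClean.{0} p 3 (QNe fun _ _ _ _ => True) fun s => s.geomDirDim ≤ 2)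
    (hcv : StrataCurveCentreDominantClean.{0} p 3 (QNe fun _ _ _ _ => True) fun s => s.geomDirDim ≤ 2)
    (hgeo : StrataLineageInCentreIO.{0} p 3 (QNe fun _ _ _ _ => True) fun s => s.geomDirDim ≤ 2) : WlowStrataM p :=
  maxOriginNoMovingNearChainAt_of_atQ_true (maxOriginNoMovingNearChainAtQ_notIso_of_geomDir_point_curve_centreIO hF hFf hpt hcv hgeo)

/-- … and the (F1)-regime row from the same binders. [cite: CossartJannsenSaito2020, Thm. 3.14, Rem. 6.29 (1)] -/
theorem wlow3CharStrataM_of_geomDir_point_curve_centreIO {p : ℕ} (hF : Theorem314_geomDir.{0})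
    (hFf : Theorem314_nearFibre_geomDir.{0})
    (hpt : StrataPointCentreMembersClean.{0} p 3 (QNe (Helpers.QCharRegime p)) fun s => s.geomDirDim ≤ 2)
    (hcv : StrataCurveCentreDominantClean.{0} p 3 (QNe (Helpers.QCharRegime p)) fun s => s.geomDirDim ≤ 2)
    (hgeo : StrataLineageInCentreIO.{0} p 3 (QNe (Helpers.QCharRegime p)) fun s => s.geomDirDim ≤ 2) :
    Wlow3CharStrataM p :=
  maxOriginNoMovingNearChainAtQ_notIso_of_geomDir_point_curve_centreIO hF hFf hpt hcv hgeo

end Summit.ResolutionOfSingularities.ResolutionOfSingularities.Theorems.SigmaMaxModificationsCorridor3.Moving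

end
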